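import Summits.ResolutionOfSingularities.ResolutionOfSingularities.Theorems.PurelyInseparableDim4TschirnhausChain
import Summits.ResolutionOfSingularities.ResolutionOfSingularities.Theorems.PurelyInseparableDim4TschirnhausCleanVertex
import HarnessLib
import HarnessLib.Audit.Tags

/-!
# Purely inseparable four-folds — TRANSPORT OF A TAIL INTO THE C∞ FRAME: a witnessed `Step0` tail whose charts
# avoid two free letters `f, u` re-frames along `x_f` and then along `x_u` to a witnessed `Step0` chain with the SAME
# charts, multiplicities, orders, shades, isolation and `e_G` (cell `res-dim4-pi`, K2(p) lane, slice B; K24c L2b)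

[OURS · counted 0 · cell `res-dim4-pi` · K2(p) lane holder res-dim4-p-12 g3; C∞ assembly owner res-dim4-p-3 g4
(design (iii) «re-frame at ONE state», bus 2026-08-29 02:51Z / 03:37Z).]  Nothing here proves K2(p)/K2(5),
`NoIsolatedTrap p p` or resolution of singularities in dimension ≥ 4 / characteristic `p` — NOT proved.  AI kernel
work, weaker than expert review.

This is bookkeeping over res-dim4-p-11 g3's brick (ii) FILE E (`FrameChange.exists_reframed_chain`: ONE admissible
re-framing `x_f ↦ x_f + φ` rides a witnessed chain whose charts avoid `f`) and FILE E part 1b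
(`FrameChange.finrank_resVertex_cleanTschState`: in the band `p ∤ ord₀ F` every admissible clean re-framing keeps
`e_G`), arranged for the C∞ assembly, which re-frames the tail of a slot chain at a letter change TWICE — the
straightening at the contact letter `f` (res-dim4-p-11 g3's linear datum `φ_ℓ`) and res-dim4-typ-1 g3's second
Tschirnhaus at the free letter `u` — and then plays res-dim4-p-2 g4's window `cInf_frame_window` on the result:
* §1 `step_eraseExc`, `isWitnessedChain_eraseExc` — erasing a never-charted letter from the bookkeeping set `exc`
  keeps a witnessed chain (so FILE E's side condition `f ∉ exc` costs nothing: `F`, `r`, charts and points are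
  untouched); `isWitnessedChain_shift` — tails of witnessed chains are witnessed chains.
* §2 **`exists_reframed_tail₂`** — given a witnessed `Step0 p` chain `(c, j, β)`, a stage `k ≥ 1`, two
  letters `f, u` charted at no stage `≥ k` and free at `k` (`r_k f = r_k u = 0`), admissible data `φ₀` (at `f`) and
  `ψ₀` (at `u`), and the band `p ∤ ord₀ F_m` with `x^{r_m} ∣ F_m` along the tail: there is a witnessed `Step0 p` chain
  `ch` with charts `m ↦ j (k + m)`, STARTING AT `ch 0 = ⟨clean (tsch u ψ₀ (clean (tsch f φ₀ F_k))), r_k, _⟩`, with, at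
  every stage, the same `r`, the same `ord₀`, the same shade, `x^r ∣ F`, isolation iff, and the SAME `e_G`.

[cite: Hauser2010, §§F–G] [cite: Kollar2007, Aside 3.57]
bears_on: LADDER-RESOLUTION:D157-DOOR2 (res-dim4-pi · K2(p) slice B · C∞ transport).
Supports stmt-ResolutionOfSingularities-16155 (helper).
-/

set_option linter.dupNamespace false -- mandated namespace of this single-conjunct summit

noncomputable section

namespace Summit.ResolutionOfSingularities.ResolutionOfSingularities.Theorems.PIDim4

namespace ResCone

open MvPolynomial Finset FrameChange
open Literature.AlgebraicGeometry.Resolution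
open Literature.AlgebraicGeometry.Resolution.CentreBlowup
open Literature.AlgebraicGeometry.Resolution.Hauser2010
open Literature.AlgebraicGeometry.Resolution.HauserPerlega2019

variable {K : Type} [Field K]

/-! ## §1 Erasing a never-charted letter from `exc`; shifting a chain -/

/-- One step of the walk commutes with erasing a letter `f ≠ j` from the bookkeeping set `exc`: the polynomial and
the multiplicities do not see `exc`, and `newExc j b` erases/filters letterwise. [folklore] -/
theorem step_eraseExc [DecidableEq K] (q : ℕ) {j f : Fin 4} (hjf : j ≠ f) (b : Fin 4 → K) (s : State K) :
    CentreBlowup.step q Finset.univ j b (⟨s.F, s.r, s.exc.erase f⟩ : State K) =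
      ⟨(CentreBlowup.step q Finset.univ j b s).F, (CentreBlowup.step q Finset.univ j b s).r,
        (CentreBlowup.step q Finset.univ j b s).exc.erase f⟩ := by
  simp only [CentreBlowup.step, CentreBlowup.newExc, CentreBlowup.newMult, CentreBlowup.pointTransform,
    Finset.erase_insert_of_ne hjf, Finset.filter_erase]

/-- **Erasing a never-charted letter from `exc` keeps a witnessed chain** (same charts, same points). [folklore] -/
theorem isWitnessedChain_eraseExc [DecidableEq K] {q : ℕ} {c : ℕ → State K} {j : ℕ → Fin 4}
    {b : ℕ → Fin 4 → K} (hw : FreeTail.IsWitnessedChain q c j b) {f : Fin 4} (hjf : ∀ k, j k ≠ f) :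
    FreeTail.IsWitnessedChain q (fun k => (⟨(c k).F, (c k).r, (c k).exc.erase f⟩ : State K)) j b := by
  intro k
  obtain ⟨h1, h2, h3, h4, h5⟩ := hw k
  refine ⟨h1, h2, h3, h4, ?_⟩
  show (⟨(c (k + 1)).F, (c (k + 1)).r, (c (k + 1)).exc.erase f⟩ : State K) = _
  rw [step_eraseExc q (hjf k) (b k) (c k), ← h5]

/-- **Tails of witnessed chains are witnessed chains.** [folklore] -/
theorem isWitnessedChain_shift [DecidableEq K] {q : ℕ} {c : ℕ → State K} {j : ℕ → Fin 4} {b : ℕ → Fin 4 → K}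
    (hw : FreeTail.IsWitnessedChain q c j b) (k : ℕ) :
    FreeTail.IsWitnessedChain q (fun m => c (k + m)) (fun m => j (k + m)) (fun m => b (k + m)) :=
  fun m => hw (k + m)

/-! ## §2 The double re-framing of a tail -/

section Chain

variable (p : ℕ) [hp : Fact p.Prime] [CharP K p] [DecidableEq K]

/-- **ONE re-framing of a tail, with `e_G`** (FILE E + part 1b, dressed): a witnessed `Step0 p` chain `(c, j, β)`
with `(c 0).F` clean, a letter `f` charted at no stage and free at `0` (`r_0 f = 0`, `f ∉ exc_0`), an admissible datum
`φ₀`, the band `p ∤ ord₀ F_m` and `x^{r_m} ∣ F_m` at every stage: the re-framed chain `ch m = ⟨clean (tsch f φ_m F_m),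
r_m, exc_m⟩` (`φ_0 = φ₀`) is a witnessed `Step0 p` chain with the same charts and, at every stage, the same `r`,
`exc`, `ord₀`, shade, `x^r ∣ F`, cleanness, isolation iff, AND the same `e_G`. [OURS · bookkeeping]
[cite: Hauser2010, §§F–G] -/
theorem exists_reframed_chain_finrank {c : ℕ → State K} {j : ℕ → Fin 4} {β : ℕ → Fin 4 → K} {f : Fin 4}
    (hw : FreeTail.IsWitnessedChain p c j β) (hclean : deletePthPowers p (c 0).F = (c 0).F)
    (hjf : ∀ k, j k ≠ f) (hr : (c 0).r f = 0) (he : f ∉ (c 0).exc)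
    (hdiv : ∀ k, ∀ e ∈ (c k).F.support, (c k).r ≤ e)
    (hband : ∀ k, ∃ o : ℕ, ordZero (c k).F = o ∧ ¬ p ∣ o)
    {φ₀ : MvPolynomial (Fin 4) K} (hφ : f ∉ φ₀.vars) (h0 : constantCoeff φ₀ = 0) :
    ∃ (φ : ℕ → MvPolynomial (Fin 4) K) (b : ℕ → Fin 4 → K) (c' : ℕ → State K),
      φ 0 = φ₀ ∧ (∀ k, f ∉ (φ k).vars ∧ constantCoeff (φ k) = 0) ∧
      (∀ k, c' k = ⟨deletePthPowers p (tsch f (φ k) (c k).F), (c k).r, (c k).exc⟩) ∧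
      FreeTail.IsWitnessedChain p c' j b ∧ (∀ k, Step0 p (c' k) (c' (k + 1))) ∧
      (∀ k i, i ≠ f → b k i = β k i) ∧
      (∀ k, (c' k).r = (c k).r ∧ (c' k).exc = (c k).exc ∧ ordZero (c' k).F = ordZero (c k).F ∧
        (c' k).shade = (c k).shade ∧ deletePthPowers p (c' k).F = (c' k).F ∧
        (IsIsolated p (c' k).F ↔ IsIsolated p (c k).F) ∧ (∀ e ∈ (c' k).F.support, (c' k).r ≤ e) ∧
        Module.finrank K (resVertex (c' k)) = Module.finrank K (resVertex (c k))) := by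
  obtain ⟨φ, b, c', hφ0, hadm, hc', hw', hstep, hb, hinv⟩ := exists_reframed_chain p hw hclean hjf hr he hφ h0
  refine ⟨φ, b, c', hφ0, hadm, hc', hw', hstep, hb, fun k => ?_⟩
  obtain ⟨h1, h2, h3, h4, h5, h6, h7⟩ := hinv k
  refine ⟨h1, h2, h3, h4, h5, h6, h7 (hdiv k), ?_⟩
  obtain ⟨o, ho, hpo⟩ := hband k
  have hrf : (c k).r f = 0 := (free_of_isWitnessedChain hw hjf hr he k).1
  rw [hc' k]
  exact finrank_resVertex_cleanTschState p (hadm k).1 (hadm k).2 hrf (hdiv k) ho hpo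

/-- **THE DOUBLE RE-FRAMING OF A TAIL** (transport into the C∞ frame).  Let `(c, j, β)` be a witnessed `Step0 p`
chain, `k ≥ 1` a stage, `f, u` two letters charted at no stage `≥ k` and free at `k` (`r_k f = r_k u = 0`), the
band `p ∤ ord₀ F_m` and `x^{r_m} ∣ F_m` from `k` on, and `φ₀`, `ψ₀` admissible data at `f` and at `u`.  Then there
is a witnessed `Step0 p` chain `ch` with charts `m ↦ j (k + m)` such that
`(ch 0).F = clean (tsch u ψ₀ (clean (tsch f φ₀ F_k)))` and, at every stage `m`, `ch m` has the multiplicities `r_{k+m}`,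
the order, the shade and the `e_G` of `c (k + m)`, `x^r ∣ F`, and is isolated iff `c (k + m)` is.  (The bookkeeping
set `exc` is first cleared of `f, u`, harmlessly: §1.) [OURS · bookkeeping] [cite: Hauser2010, §§F–G] -/
theorem exists_reframed_tail₂ {c : ℕ → State K} {j : ℕ → Fin 4} {β : ℕ → Fin 4 → K}
    (hw : FreeTail.IsWitnessedChain p c j β) {k : ℕ} (hk : 1 ≤ k) {f u : Fin 4}
    (hjf : ∀ m, k ≤ m → j m ≠ f) (hju : ∀ m, k ≤ m → j m ≠ u) (hrf : (c k).r f = 0) (hru : (c k).r u = 0)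
    (hdiv : ∀ m, ∀ e ∈ (c m).F.support, (c m).r ≤ e)
    (hband : ∀ m, k ≤ m → ∃ o : ℕ, ordZero (c m).F = o ∧ ¬ p ∣ o)
    {φ₀ : MvPolynomial (Fin 4) K} (hφ : f ∉ φ₀.vars) (hφ0 : constantCoeff φ₀ = 0)
    {ψ₀ : MvPolynomial (Fin 4) K} (hψ : u ∉ ψ₀.vars) (hψ0 : constantCoeff ψ₀ = 0) :
    ∃ (ch : ℕ → State K) (bh : ℕ → Fin 4 → K),
      FreeTail.IsWitnessedChain p ch (fun m => j (k + m)) bh ∧ (∀ m, Step0 p (ch m) (ch (m + 1))) ∧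
      (ch 0).F = deletePthPowers p (tsch u ψ₀ (deletePthPowers p (tsch f φ₀ (c k).F))) ∧
      (∀ m, (ch m).r = (c (k + m)).r ∧ ordZero (ch m).F = ordZero (c (k + m)).F ∧
        (ch m).shade = (c (k + m)).shade ∧ (IsIsolated p (ch m).F ↔ IsIsolated p (c (k + m)).F) ∧
        (∀ e ∈ (ch m).F.support, (ch m).r ≤ e) ∧
        Module.finrank K (resVertex (ch m)) = Module.finrank K (resVertex (c (k + m)))) := by
  -- the tail from `k`, with `f` and `u` erased from the bookkeeping set
  set c₁ : ℕ → State K := fun m =>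
    (⟨(c (k + m)).F, (c (k + m)).r, ((c (k + m)).exc.erase f).erase u⟩ : State K) with hc₁
  have hjf' : ∀ m, j (k + m) ≠ f := fun m => hjf (k + m) (Nat.le_add_right k m)
  have hju' : ∀ m, j (k + m) ≠ u := fun m => hju (k + m) (Nat.le_add_right k m)
  have hw₁ : FreeTail.IsWitnessedChain p c₁ (fun m => j (k + m)) (fun m => β (k + m)) := by
    have h := isWitnessedChain_eraseExc
      (isWitnessedChain_eraseExc (isWitnessedChain_shift hw k) (f := f) hjf') (f := u) hju'
    exact h
  have hclean₁ : deletePthPowers p (c₁ 0).F = (c₁ 0).F := by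
    obtain ⟨k', rfl⟩ : ∃ k', k = k' + 1 := ⟨k - 1, by omega⟩
    show deletePthPowers p (c (k' + 1 + 0)).F = (c (k' + 1 + 0)).F
    rw [Nat.add_zero, (hw k').2.2.2.2]
    exact deletePthPowers_step_F p Finset.univ (j k') (β k') (c k')
  have hdiv₁ : ∀ m, ∀ e ∈ (c₁ m).F.support, (c₁ m).r ≤ e := fun m => hdiv (k + m)
  have hband₁ : ∀ m, ∃ o : ℕ, ordZero (c₁ m).F = o ∧ ¬ p ∣ o := fun m => hband (k + m) (Nat.le_add_right k m)
  have he₁ : f ∉ (c₁ 0).exc := fun h =>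
    Finset.notMem_erase f _ (Finset.mem_of_mem_erase h)
  -- first re-framing, at `f`
  obtain ⟨φ, b₁, c₁', hφ0', hadm₁, hc₁', hw₁', -, -, hinv₁⟩ :=
    exists_reframed_chain_finrank p hw₁ hclean₁ hjf' hrf he₁ hdiv₁ hband₁ hφ hφ0
  -- second re-framing, at `u`
  have hclean₁' : deletePthPowers p (c₁' 0).F = (c₁' 0).F := (hinv₁ 0).2.2.2.2.1
  have hru₁' : (c₁' 0).r u = 0 := by rw [(hinv₁ 0).1]; exact hru
  have heu₁' : u ∉ (c₁' 0).exc := by rw [(hinv₁ 0).2.1]; exact Finset.notMem_erase u _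
  have hdiv₁' : ∀ m, ∀ e ∈ (c₁' m).F.support, (c₁' m).r ≤ e := fun m => (hinv₁ m).2.2.2.2.2.2.1
  have hband₁' : ∀ m, ∃ o : ℕ, ordZero (c₁' m).F = o ∧ ¬ p ∣ o := fun m => by
    obtain ⟨o, ho, hpo⟩ := hband₁ m
    exact ⟨o, by rw [(hinv₁ m).2.2.1]; exact ho, hpo⟩
  obtain ⟨ψ, b₂, c₂', hψ0', hadm₂, hc₂', hw₂', hstep₂, -, hinv₂⟩ :=
    exists_reframed_chain_finrank p hw₁' hclean₁' hju' hru₁' heu₁' hdiv₁' hband₁' hψ hψ0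
  refine ⟨c₂', b₂, hw₂', hstep₂, ?_, fun m => ?_⟩
  · rw [hc₂' 0, hψ0', hc₁' 0, hφ0']
    show deletePthPowers p (tsch u ψ₀ (deletePthPowers p (tsch f φ₀ (c (k + 0)).F))) = _
    rw [Nat.add_zero]
  · obtain ⟨h1, -, h3, h4, -, h6, h7, h8⟩ := hinv₂ m
    obtain ⟨g1, -, g3, g4, -, g6, -, g8⟩ := hinv₁ m
    exact ⟨h1.trans g1, h3.trans g3, h4.trans g4, h6.trans g6, h7, h8.trans g8⟩

end Chain

end ResCone

end Summit.ResolutionOfSingularities.ResolutionOfSingularities.Theorems.PIDim4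

end
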